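import Literature.NumberTheory.EllipticCurves.SzpiroLocalDataProofs
import Literature.NumberTheory.DiophantineGeometry.MinimalDiscriminantNormProofs
import HarnessLib

/-!
# Integral Weierstrass equations over `ℤ` versus the minimal discriminant:
# `ord_p Δ(W₀) = ord_p(Δ_min) + 12k` with `p^{4k} ∣ c₄(W₀)`, `p^{6k} ∣ c₆(W₀)`

Topic `Literature/NumberTheory/EllipticCurves`; a proofs-only file (theorems only: no definition,
no named fact; D-0026). Silverman, *The Arithmetic of Elliptic Curves*, VII.1: for a Weierstrass
equation with `v`-integral coefficients, a change of variables `(u, r, s, t)` to a minimal equation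
at `v` has `u` integral (Prop. 1.3 (a) with the Definition: the minimal equation minimises
`ord_v(Δ)` over the integral equations, and `Δ_min = u⁻¹²Δ`), and then `c₄' = u⁻⁴c₄`,
`c₆' = u⁻⁶c₆` are again integral (Remark 1.1: "`u⁴ ∣ c₄`, `u⁶ ∣ c₆`, `u¹² ∣ Δ`"). Over `ℤ ⊆ ℚ`, at
the place `v` above the rational prime `p`, this reads:

* `exists_ordMinimalDiscriminant_add_eq_padicValInt`: for `W₀ : WeierstrassCurve ℤ` with `W₀ ⊗ ℚ`
  elliptic there is `k : ℕ` with `ord_v(Δ_min(W₀ ⊗ ℚ)) + 12k = ord_p Δ(W₀)`, `p^{4k} ∣ c₄(W₀)` and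
  `p^{6k} ∣ c₆(W₀)`.

This is the local form of the sentence *"we obtain `u ∈ ℤ` such that `u¹²Δ_{E'} = ±Δ'`, `u⁴ ∣ c₄`
and `u⁶ ∣ c₆`"* in von Känel–Matschke's proof of their Lemma 10.5 (arXiv:1605.06079, §10.4), for
which it was written (`FreyHellegouarchTwoIsogenousCurveProofs`). The proof runs on the tree's
local apparatus (`LocalReduction`, `MinimalDiscriminant`): the chosen local minimal model is
`D • (W₀ ⊗ ℚ_v)`; minimality read through `isMinimal_iff_of_le_one_iff` against the integral
equation `W₀` gives `|D.u⁻¹|ᵥ ≥ 1`; integrality of the minimal model's `c₄, c₆`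
(`integralModel_c₄_eq`) gives the divisibilities; `ord_v(Δ_min)` is read off with
`exists_addVal_adicCompletionIntegers_eq`, and `v`-adic valuations of integers are converted to
divisibilities by `Rat.valuation_intCast_le_exp_iff`.

## References

* [SilvermanAEC2009] J. H. Silverman, *The Arithmetic of Elliptic Curves*, 2nd ed., GTM 106,
  VII.1 (Definition of a minimal equation, Remark 1.1, Prop. 1.3).
* [VonkanelMatschke2023] R. von Känel, B. Matschke, arXiv:1605.06079 = Mem. AMS 286 (2023),
  proof of Lemma 10.5 (the use made of this statement).
-/

noncomputable section

open IsDedekindDomain WeierstrassCurve Rat.HeightOneSpectrum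

namespace Literature.NumberTheory.EllipticCurves

section Local

variable (v : HeightOneSpectrum ℤ) (W₀ : WeierstrassCurve ℤ)

/-- **Silverman, AEC VII.1 (Prop. 1.3 and Remark 1.1), quantitative form for an integral equation.**
Let `W₀` be a Weierstrass equation over `ℤ` with `W₀ ⊗ ℚ` elliptic and `v` the place above the prime
`p`. Then there is `k : ℕ` (the `v`-adic order of the scaling `u` from `W₀` to a minimal equation at
`v`) with `ord_v(Δ_min) + 12k = ord_p Δ(W₀)`, `p^{4k} ∣ c₄(W₀)` and `p^{6k} ∣ c₆(W₀)`: the chosen local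
minimal model is `D • (W₀ ⊗ ℚ_p)` with `Δ_min = u⁻¹²Δ`, `c₄' = u⁻⁴c₄`, `c₆' = u⁻⁶c₆` all `p`-integral
(`u⁻¹ = D.u`), and `|u⁻¹|ᵥ ≥ 1` because the integral equation `W₀` cannot have a discriminant of
smaller order than the minimal one. [cite: SilvermanAEC2009, VII.1 Prop. 1.3 and Remark 1.1] -/
theorem exists_ordMinimalDiscriminant_add_eq_padicValInt [(W₀.baseChange ℚ).IsElliptic] :
    ∃ k : ℕ, (W₀.baseChange ℚ).ordMinimalDiscriminant v + 12 * k =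
        padicValInt (natGenerator v) W₀.Δ ∧
      (natGenerator v : ℤ) ^ (4 * k) ∣ W₀.c₄ ∧ (natGenerator v : ℤ) ^ (6 * k) ∣ W₀.c₆ := by
  haveI : Fact (natGenerator v).Prime := ⟨prime_natGenerator v⟩
  set W := W₀.baseChange ℚ with hWdef
  set X := W.baseChange (v.adicCompletion ℚ) with hX
  obtain ⟨D, hD⟩ : ∃ D : VariableChange (v.adicCompletion ℚ), W.localMinimalModel v = D • X :=
    ⟨_, rfl⟩
  -- values of `Δ, c₄, c₆` of `X` read in `ℚ`
  have hXΔ : Valued.v X.Δ = v.valuation ℚ (W₀.Δ : ℚ) := by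
    rw [hX, hWdef, ← eq_intCast (algebraMap ℤ ℚ) W₀.Δ]
    simp only [baseChange, map_Δ, valued_algebraMap_adicCompletion]
  have hXc₄ : Valued.v X.c₄ = v.valuation ℚ (W₀.c₄ : ℚ) := by
    rw [hX, hWdef, ← eq_intCast (algebraMap ℤ ℚ) W₀.c₄]
    simp only [baseChange, map_c₄, valued_algebraMap_adicCompletion]
  have hXc₆ : Valued.v X.c₆ = v.valuation ℚ (W₀.c₆ : ℚ) := by
    rw [hX, hWdef, ← eq_intCast (algebraMap ℤ ℚ) W₀.c₆]
    simp only [baseChange, map_c₆, valued_algebraMap_adicCompletion]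
  have hΔ0 : W₀.Δ ≠ 0 := Δ_ne_zero_of_isElliptic_baseChange_int W₀
  have hXΔ0 : Valued.v X.Δ ≠ 0 := by
    rw [hXΔ, Valuation.ne_zero_iff]
    exact_mod_cast hΔ0
  -- the scaling factor `a = |u⁻¹|ᵥ`
  set a := Valued.v (↑D.u⁻¹ : v.adicCompletion ℚ) with ha
  have ha0 : a ≠ 0 := by simp [ha]
  -- minimality of `D • X` against the integral equation `X = D⁻¹ • (D • X)`
  have hmin : (D • X).IsMinimal (v.adicCompletionIntegers ℚ) := by rw [← hD]; exact inferInstance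
  have hXint : X.IsIntegral (v.adicCompletionIntegers ℚ) := isIntegralAt_baseChange_int v W₀
  have hle : Valued.v X.Δ ≤ Valued.v (D • X).Δ := by
    have h := ((isMinimal_iff_of_le_one_iff (valued_le_one_iff_mem_range_adicCompletionIntegers v)
      (D • X)).mp hmin).2 D⁻¹ (by rwa [inv_smul_smul])
    rwa [inv_smul_smul] at h
  rw [variableChange_Δ, Valuation.map_mul, Valuation.map_pow] at hle
  -- hence `1 ≤ a`
  have ha1 : 1 ≤ a := by
    by_contra hlt
    rw [not_le] at hlt
    have : a ^ 12 * Valued.v X.Δ < 1 * Valued.v X.Δ := by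
      refine mul_lt_mul_of_pos_right ?_ (zero_lt_iff.mpr hXΔ0)
      exact pow_lt_one₀ zero_le hlt (by norm_num)
    rw [one_mul] at this
    exact absurd hle (not_le.mpr this)
  -- `a = exp k` with `k : ℕ`
  have hk0 : 0 ≤ WithZero.log a := by
    rw [← WithZero.log_one]; exact (WithZero.log_le_log one_ne_zero ha0).mpr ha1
  obtain ⟨k, hk⟩ := Int.eq_ofNat_of_zero_le hk0
  have hak : a = WithZero.exp (k : ℤ) := by rw [← hk]; exact (WithZero.exp_log ha0).symm
  have hpow : ∀ n : ℕ, a ^ n = WithZero.exp ((n : ℤ) * k) := by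
    intro n
    rw [hak, ← WithZero.exp_nsmul, nsmul_eq_mul]
  -- integrality of `c₄`, `c₆` of the minimal model
  have hint₄ : Valued.v (D • X).c₄ ≤ 1 := by
    haveI := hmin
    rw [← integralModel_c₄_eq (v.adicCompletionIntegers ℚ) (D • X)]
    exact (valued_le_one_iff_mem_range_adicCompletionIntegers v _).mpr ⟨_, rfl⟩
  have hint₆ : Valued.v (D • X).c₆ ≤ 1 := by
    haveI := hmin
    rw [← integralModel_c₆_eq (v.adicCompletionIntegers ℚ) (D • X)]
    exact (valued_le_one_iff_mem_range_adicCompletionIntegers v _).mpr ⟨_, rfl⟩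
  rw [variableChange_c₄, Valuation.map_mul, Valuation.map_pow] at hint₄
  rw [variableChange_c₆, Valuation.map_mul, Valuation.map_pow] at hint₆
  -- `v(c₄) ≤ exp(-4k)`, `v(c₆) ≤ exp(-6k)`: cancel `a ^ n = exp (n k)`
  have cancel : ∀ (n : ℕ) (x : WithZero (Multiplicative ℤ)), a ^ n * x ≤ 1 →
      x ≤ WithZero.exp (-((n : ℤ) * k)) := by
    intro n x hx
    have h : WithZero.exp ((n : ℤ) * k) * x ≤ WithZero.exp ((n : ℤ) * k) *
        WithZero.exp (-((n : ℤ) * k)) := by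
      rw [← WithZero.exp_add, add_neg_cancel, WithZero.exp_zero, ← hpow]
      exact hx
    exact le_of_mul_le_mul_left h WithZero.exp_pos
  have hc₄ : (natGenerator v : ℤ) ^ (4 * k) ∣ W₀.c₄ := by
    rw [← Literature.NumberTheory.EllipticCurves.Rat.valuation_intCast_le_exp_iff, ← hXc₄]
    exact_mod_cast cancel 4 _ hint₄
  have hc₆ : (natGenerator v : ℤ) ^ (6 * k) ∣ W₀.c₆ := by
    rw [← Literature.NumberTheory.EllipticCurves.Rat.valuation_intCast_le_exp_iff, ← hXc₆]
    exact_mod_cast cancel 6 _ hint₆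
  -- the order of the minimal discriminant
  have hMΔ : algebraMap (v.adicCompletionIntegers ℚ) (v.adicCompletion ℚ)
      (W.localMinimalIntegralModel v).Δ = (W.localMinimalModel v).Δ :=
    integralModel_Δ_eq (v.adicCompletionIntegers ℚ) _
  have hmin0 : (W.localMinimalIntegralModel v).Δ ≠ 0 := by
    intro h0
    have h1 : (W.localMinimalModel v).Δ = 0 := by rw [← hMΔ, h0, map_zero]
    rw [hD, variableChange_Δ] at h1
    have h2 : Valued.v ((↑D.u⁻¹ : v.adicCompletion ℚ) ^ 12 * X.Δ) = 0 := by
      rw [h1, Valuation.map_zero]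
    rw [Valuation.map_mul, Valuation.map_pow] at h2
    exact mul_ne_zero (pow_ne_zero _ ha0) hXΔ0 h2
  obtain ⟨n, hn, hvn⟩ :=
    HeightOneSpectrum.exists_addVal_adicCompletionIntegers_eq ℚ v _ hmin0
  have hord : W.ordMinimalDiscriminant v = n := by
    rw [ordMinimalDiscriminant, hn]; rfl
  have hval : a ^ 12 * Valued.v X.Δ = WithZero.exp (-(n : ℤ)) := by
    rw [← hvn]
    change _ = Valued.v (algebraMap (v.adicCompletionIntegers ℚ) (v.adicCompletion ℚ)
      (W.localMinimalIntegralModel v).Δ)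
    rw [hMΔ, hD, variableChange_Δ, Valuation.map_mul, Valuation.map_pow]
  -- `v(Δ(W₀)) = exp(-(n + 12k))`
  have hΔval : v.valuation ℚ (W₀.Δ : ℚ) = WithZero.exp (-((n : ℤ) + 12 * k)) := by
    rw [← hXΔ]
    have h : WithZero.exp ((12 : ℕ) * (k : ℤ)) * Valued.v X.Δ =
        WithZero.exp ((12 : ℕ) * (k : ℤ)) * WithZero.exp (-((n : ℤ) + 12 * k)) := by
      rw [← WithZero.exp_add, ← hpow, hval]
      congr 1
      push_cast
      ring
    exact mul_left_cancel₀ WithZero.exp_ne_zero h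
  -- read off `padicValInt`
  have hpadic : padicValInt (natGenerator v) W₀.Δ = n + 12 * k := by
    have key : ∀ m : ℕ, (natGenerator v : ℤ) ^ m ∣ W₀.Δ ↔ m ≤ n + 12 * k := by
      intro m
      rw [← Literature.NumberTheory.EllipticCurves.Rat.valuation_intCast_le_exp_iff v W₀.Δ m,
        hΔval, WithZero.exp_le_exp, neg_le_neg_iff]
      norm_cast
    apply le_antisymm
    · exact (key _).mp (padicValInt_dvd _)
    · rcases (padicValInt_dvd_iff _ _).mp ((key _).mpr le_rfl) with h | h
      · exact absurd h hΔ0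
      · exact h
  exact ⟨k, by rw [hord, hpadic], hc₄, hc₆⟩

end Local

end Literature.NumberTheory.EllipticCurves

end
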